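/-
Copyright (c) 2026 the pub-hodgecm-mathlib formalisation cell (harness21).  Prover seat hodgecm-mathlib-K2Liu-p09 (g4): Track B «K2-LIT», #184♮ = hLiu418,
Road I organ (A-int)-fin, DEFS brick (β-2) «the Kudla–Rallis mixed-model map `r_w`» (K2E5-plan (g5) co-deal 06:42:58Z, PIN (b) M-156g (3); LEAD F0P6-plan (g12)
RULINGS (β) 07:08:32Z, M-156i 07:17:32Z «`r_w` by-value binder + laws until D-A′(β)»).
-/
import Summits.HodgeConjecture.HodgeConjecture.Theorems.K2LiuSchwartzBruhatFiberIntegral  -- ★ p858160 bricks (fiber integral ∕ pull-back ∕ restriction stay Schwartz–Bruhat)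
import Literature.RepresentationTheory.HeisenbergGroup.SchrodingerWeylElement            -- ★ `integrable_of_mem_schwartzBruhat`
import Mathlib.MeasureTheory.Integral.Bochner.Basic
import HarnessLib

/-!
# Crux `HLiu418`, Track B road `K2_Liu`, Road I organ (A-int)-fin — DEFS brick (β-2): THE KUDLA–RALLIS MIXED-MODEL MAP `r = restrict ∘ fiberIntegral ∘ frame`
# (`𝒮(X) → 𝒮(F^β)`, HYPOTHESIS-FIRST in the frame `θ` and the measure `μ`), its linearity, and the unramified value on a characteristic function

Cell `hodgecm-mathlib`, crux item hLiu418 = `stmt-HodgeConjecture-24832`, route of record `HCCMUnconditional`; squad K2 ∕ K2Liu, prover K2Liu-p09 (g4);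
definition lane, `--supports stmt-HodgeConjecture-24832 --as helper`.  DEFINITIONS WITH BODIES + theorems; no instance, no notation, no named fact, no `sorry`.

PIN (b) (M-156g (3), SIGS v3 §A-int l.123): in the doubling-polarised model `𝒮(V′_w ⊗ X_W)` and a Witt frame `V′_w = X′ ⊕ a′_w ⊕ Y′` the Kudla–Rallis map is
`(r_w Φ)(u) := ∫_{x ∈ X′ ⊗ X_W} Φ(x + u) dx` for `u ∈ a′_w ⊗ X_W` (the `Y′ ⊗ X_W`-coordinate put to `0`), `dx` self-dual.  This file types EXACTLY that recipe GENERICALLY,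
hypothesis-first in the two pieces of data a place `w` supplies — a MIXED-MODEL FRAME `θ : X ≃ₜ ((β ⊕ γ) ⊕ α → F)` (coordinates: `β` = the kept block `a′_w ⊗ X_W`,
`γ` = the block `Y′ ⊗ X_W` restricted to `0`, `α` = the integrated block `X′ ⊗ X_W`; for `r_w`: `X := L⁺_w^{n'+n'} = X_Δ` of (β-1) `K2LiuDoublingSchrodingerModelDefs`, `θ_w` = Witt
frame ★ `K2LiuHermitianWittFrame.exists_wittFrame_three` ⊗ `1_{X_W}` read in `L⁺_w`-coordinates) and a measure `μ` on `α → F` (for `r_w`: the `ψ_w∘tr`-self-dual Haar measure):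
* §1 `krPoint θ u a := θ⁻¹((u ⊔ 0) ⊔ a)`, the two closed coordinate embeddings, **`krFun θ μ Φ u := ∫ Φ (krPoint θ u a) dμ(a)`** and `krFun_mem` (Schwartz–Bruhat to Schwartz–Bruhat,
  ★ p858160: pull back along `θ⁻¹`, integrate the `α`-block, restrict along `u ↦ u ⊔ 0`);
* §2 **`krMap θ μ : 𝒮(X) →ₗ[ℂ] 𝒮(β → F)`** — the Kudla–Rallis map as a `ℂ`-linear map (`krMap_apply`, `coe_krMap_apply`);
* §3 **`krFun_indicator_pi`**: on the characteristic function of a frame box `θ⁻¹(O^{(β ⊕ γ) ⊕ α})` with `0 ∈ O` open, `r Φ = μ(O^α) · 𝟙_{O^β}` — the unramified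
  normalisation `r_w 𝟙_{V′(𝒪_w) ⊗ X_W(𝒪_w)} = 𝟙_{a′(𝒪_w) ⊗ X_W(𝒪_w)}` once `μ(O^α) = 1` (PIN (b): `⊗′_w r_w` lives on the restricted tensor product).
* §4 **A1 `krMap_surjective`**: `r` is SURJECTIVE `𝒮(X) ↠ 𝒮(F^β)` — the section `g ↦ (g ⊗ χ ⊗ φ) ∘ θ` (`liftFun`, `liftFun_mem`, `krFun_liftFun`) for test functions
  `χ(0) = 1`, `∫ φ dμ = 1` (hypothesis-first; at `w`: `𝟙_{𝒪^γ}`, `vol⁻¹ 𝟙_{𝒪^α}`).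
NOT here: the Witt-frame homeomorphism `θ_w` of the big datum at `w` and the self-dual measure BY NAME (consumers bind `(θ, μ)`; (β-3) pins them with the implementer `Γ_w`),
A2-equivariance of `r_w` (sequel file, geometric in the doubling-polarised model of (β-1)).

HONEST LABEL: HC_CM is proved only modulo the printed citations (2 remaining named inputs: hLiu418 = stmt-HodgeConjecture-24832,
h413 = stmt-HodgeConjecture-24833) until rung 0 closes; this file defines a carrier and closes no item.
References: [KudlaRallis1994] §1; [Kudla1994] §3; [Liu2011] §2B, §2D; [HarrisKudlaSweet1996] §4, §6 (6.16); [Weil1964] n° 11.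
-/

set_option autoImplicit false
set_option linter.dupNamespace false

noncomputable section

open MeasureTheory Topology
open Literature.NumberTheory.Automorphic Literature.RepresentationTheory.HeisenbergGroup
open Summit.HodgeConjecture.HodgeConjecture.Cruxes.HLiu418.K2LiuSchwartzBruhatFiberIntegral

namespace Summit.HodgeConjecture.HodgeConjecture.Cruxes.HLiu418.K2LiuKudlaRallisMapDefs

variable {X : Type*} [TopologicalSpace X] {F : Type*} [TopologicalSpace F] [Zero F] {α β γ : Type*}

/-! ## §1 The mixed-model slice and the fiber integral -/

/-- the point `θ⁻¹((u ⊔ 0) ⊔ a) ∈ X` of the mixed-model slice over `u ∈ F^β` (`γ`-block `0`, `α`-block `a`). [cite: KudlaRallis1994, §1] -/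
def krPoint (θ : X ≃ₜ ((β ⊕ γ) ⊕ α → F)) (u : β → F) (a : α → F) : X :=
  θ.symm (Sum.elim (Sum.elim u 0) a)

/-- unfolding. [cite: KudlaRallis1994, §1] -/
theorem krPoint_eq (θ : X ≃ₜ ((β ⊕ γ) ⊕ α → F)) (u : β → F) (a : α → F) : krPoint θ u a = θ.symm (Sum.elim (Sum.elim u 0) a) :=
  rfl

/-- the frame coordinates of the slice point: `θ (krPoint θ u a) = (u ⊔ 0) ⊔ a`. [cite: KudlaRallis1994, §1] -/
theorem apply_krPoint (θ : X ≃ₜ ((β ⊕ γ) ⊕ α → F)) (u : β → F) (a : α → F) : θ (krPoint θ u a) = Sum.elim (Sum.elim u 0) a :=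
  θ.apply_symm_apply _

omit [TopologicalSpace X] in
/-- `u ↦ u ⊔ 0 : F^β → F^{β ⊕ γ}` is a closed embedding (retraction `c ↦ c ∘ inl`). [cite: Weil1964, n° 11] -/
theorem isClosedEmbedding_sumElim_zero [T2Space F] : IsClosedEmbedding fun u : β → F => (Sum.elim u (0 : γ → F) : β ⊕ γ → F) :=
  Function.LeftInverse.isClosedEmbedding (f := fun c : β ⊕ γ → F => fun b => c (Sum.inl b)) (fun _ => rfl)
    (continuous_pi fun b => continuous_apply (Sum.inl b))
    (continuous_pi fun i => by
      cases i with
      | inl b => exact continuous_apply b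
      | inr c => exact continuous_const)

omit [TopologicalSpace X] [Zero F] in
/-- `a ↦ c ⊔ a : F^α → F^{κ ⊕ α}` is a closed embedding (retraction `d ↦ d ∘ inr`). [cite: Weil1964, n° 11] -/
theorem isClosedEmbedding_sumElim_right [T2Space F] {κ : Type*} (c : κ → F) : IsClosedEmbedding fun a : α → F => (Sum.elim c a : κ ⊕ α → F) :=
  Function.LeftInverse.isClosedEmbedding (f := fun d : κ ⊕ α → F => fun i => d (Sum.inr i)) (fun _ => rfl)
    (continuous_pi fun i => continuous_apply (Sum.inr i))
    (continuous_pi fun i => by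
      cases i with
      | inl k => exact continuous_const
      | inr j => exact continuous_apply j)

variable [MeasurableSpace (α → F)]

/-- **the Kudla–Rallis fiber integral** `(r Φ)(u) := ∫_{F^α} Φ(θ⁻¹((u ⊔ 0) ⊔ a)) dμ(a)` — integrate the `α`-block, put the `γ`-block to `0`, keep the `β`-block.
[cite: KudlaRallis1994, §1] [cite: Liu2011, §2D] -/
def krFun (θ : X ≃ₜ ((β ⊕ γ) ⊕ α → F)) (μ : Measure (α → F)) (Φ : X → ℂ) (u : β → F) : ℂ :=
  ∫ a, Φ (krPoint θ u a) ∂μ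

/-- unfolding. [cite: KudlaRallis1994, §1] -/
theorem krFun_apply (θ : X ≃ₜ ((β ⊕ γ) ⊕ α → F)) (μ : Measure (α → F)) (Φ : X → ℂ) (u : β → F) :
    krFun θ μ Φ u = ∫ a, Φ (θ.symm (Sum.elim (Sum.elim u 0) a)) ∂μ :=
  rfl

/-- **Schwartz–Bruhat to Schwartz–Bruhat**: `r Φ ∈ 𝒮(F^β)` for `Φ ∈ 𝒮(X)` (★ p858160: pull back along the frame, integrate a block, restrict to a closed slice).
[cite: Weil1964, n° 11] [cite: KudlaRallis1994, §1] -/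
theorem krFun_mem [T2Space F] (θ : X ≃ₜ ((β ⊕ γ) ⊕ α → F)) (μ : Measure (α → F)) {Φ : X → ℂ} (hΦ : Φ ∈ SchwartzBruhat X) :
    krFun θ μ Φ ∈ SchwartzBruhat (β → F) :=
  comp_isClosedEmbedding_mem_schwartzBruhat isClosedEmbedding_sumElim_zero
    (integral_sum_elim_mem_schwartzBruhat μ (comp_homeomorph_mem_schwartzBruhat θ.symm hΦ))

omit [MeasurableSpace (α → F)] in
/-- the slice integrand `a ↦ Φ(θ⁻¹((u ⊔ 0) ⊔ a))` is Schwartz–Bruhat on `F^α`. [cite: Weil1964, n° 11] -/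
theorem slice_mem [T2Space F] (θ : X ≃ₜ ((β ⊕ γ) ⊕ α → F)) {Φ : X → ℂ} (hΦ : Φ ∈ SchwartzBruhat X) (u : β → F) :
    (fun a : α → F => Φ (krPoint θ u a)) ∈ SchwartzBruhat (α → F) :=
  comp_isClosedEmbedding_mem_schwartzBruhat (isClosedEmbedding_sumElim_right (Sum.elim u 0)) (comp_homeomorph_mem_schwartzBruhat θ.symm hΦ)

/-- the slice integrand is integrable for any measure finite on compacts. [folklore] -/
theorem integrable_slice [T2Space F] [OpensMeasurableSpace (α → F)] (θ : X ≃ₜ ((β ⊕ γ) ⊕ α → F)) (μ : Measure (α → F))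
    [IsFiniteMeasureOnCompacts μ] {Φ : X → ℂ} (hΦ : Φ ∈ SchwartzBruhat X) (u : β → F) :
    Integrable (fun a : α → F => Φ (krPoint θ u a)) μ :=
  integrable_of_mem_schwartzBruhat μ (slice_mem θ hΦ u)

/-! ## §2 The Kudla–Rallis map as a linear map `𝒮(X) →ₗ[ℂ] 𝒮(F^β)` -/

/-- **THE KUDLA–RALLIS MIXED-MODEL MAP** `r_{θ,μ} : 𝒮(X) →ₗ[ℂ] 𝒮(F^β)`, `Φ ↦ (u ↦ ∫ Φ(θ⁻¹((u ⊔ 0) ⊔ a)) dμ(a))`.  For the (A-int)-fin organ: `r_w := krMap θ_w μ_w` with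
`θ_w` the Witt-frame coordinates of `X_Δ = L⁺_w^{n'+n'}` and `μ_w` self-dual. [cite: KudlaRallis1994, §1] [cite: Liu2011, §2D] [cite: HarrisKudlaSweet1996, §4] -/
def krMap [T2Space F] [OpensMeasurableSpace (α → F)] (θ : X ≃ₜ ((β ⊕ γ) ⊕ α → F)) (μ : Measure (α → F)) [IsFiniteMeasureOnCompacts μ] :
    SchwartzBruhat X →ₗ[ℂ] SchwartzBruhat (β → F) where
  toFun Φ := ⟨krFun θ μ Φ, krFun_mem θ μ Φ.2⟩
  map_add' Φ Ψ := Subtype.ext <| funext fun u => integral_add (integrable_slice θ μ Φ.2 u) (integrable_slice θ μ Ψ.2 u)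
  map_smul' c Φ := Subtype.ext <| funext fun u => integral_smul c fun a => (Φ : X → ℂ) (krPoint θ u a)

/-- unfolding (as a function). [cite: KudlaRallis1994, §1] -/
theorem coe_krMap_apply [T2Space F] [OpensMeasurableSpace (α → F)] (θ : X ≃ₜ ((β ⊕ γ) ⊕ α → F)) (μ : Measure (α → F))
    [IsFiniteMeasureOnCompacts μ] (Φ : SchwartzBruhat X) :
    ((krMap θ μ Φ : SchwartzBruhat (β → F)) : (β → F) → ℂ) = krFun θ μ Φ :=
  rfl

/-- unfolding (pointwise). [cite: KudlaRallis1994, §1] -/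
theorem krMap_apply [T2Space F] [OpensMeasurableSpace (α → F)] (θ : X ≃ₜ ((β ⊕ γ) ⊕ α → F)) (μ : Measure (α → F))
    [IsFiniteMeasureOnCompacts μ] (Φ : SchwartzBruhat X) (u : β → F) :
    ((krMap θ μ Φ : SchwartzBruhat (β → F)) : (β → F) → ℂ) u = ∫ a, (Φ : X → ℂ) (θ.symm (Sum.elim (Sum.elim u 0) a)) ∂μ :=
  rfl

/-! ## §3 The unramified value: `r 𝟙_{θ⁻¹(O^{(β⊕γ)⊕α})} = μ(O^α) · 𝟙_{O^β}` -/

omit [TopologicalSpace X] [TopologicalSpace F] [MeasurableSpace (α → F)] in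
/-- membership of `(u ⊔ 0) ⊔ a` in a box `O^{(β ⊕ γ) ⊕ α}` with `0 ∈ O`. [cite: KudlaRallis1994, §1] -/
theorem sumElim_mem_pi_iff {O : Set F} (h0 : (0 : F) ∈ O) (u : β → F) (a : α → F) :
    Sum.elim (Sum.elim u 0) a ∈ Set.univ.pi (fun _ : (β ⊕ γ) ⊕ α => O) ↔
      u ∈ Set.univ.pi (fun _ : β => O) ∧ a ∈ Set.univ.pi (fun _ : α => O) := by
  simp only [Set.mem_univ_pi, Sum.forall, Sum.elim_inl, Sum.elim_inr, Pi.zero_apply]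
  exact ⟨fun h => ⟨h.1.1, h.2⟩, fun h => ⟨⟨h.1, fun _ => h0⟩, h.2⟩⟩

/-- **the unramified value of the Kudla–Rallis map**: if `Φ = 𝟙_{O^{(β⊕γ)⊕α}} ∘ θ` (`O ∋ 0` open, e.g. `O = 𝒪_w`), then `r Φ = μ(O^α) · 𝟙_{O^β}` — with `μ(𝒪_w^α) = 1`
(self-dual measure, unramified `ψ_w`) this is `r_w 𝟙_{V′(𝒪_w) ⊗ X_W(𝒪_w)} = 𝟙_{a′(𝒪_w) ⊗ X_W(𝒪_w)}`. [cite: KudlaRallis1994, §1] [cite: Liu2011, §2D] -/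
theorem krFun_indicator_pi [Finite α] [OpensMeasurableSpace (α → F)] (θ : X ≃ₜ ((β ⊕ γ) ⊕ α → F)) (μ : Measure (α → F))
    {O : Set F} (hO : IsOpen O) (h0 : (0 : F) ∈ O) {Φ : X → ℂ}
    (hΦ : ∀ x, Φ x = (Set.univ.pi fun _ : (β ⊕ γ) ⊕ α => O).indicator (fun _ => (1 : ℂ)) (θ x)) (u : β → F) :
    krFun θ μ Φ u = (μ.real (Set.univ.pi fun _ : α => O) : ℂ) * (Set.univ.pi fun _ : β => O).indicator (fun _ => (1 : ℂ)) u := by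
  have hmeas : MeasurableSet (Set.univ.pi fun _ : α => O) := (isOpen_set_pi Set.finite_univ fun _ _ => hO).measurableSet
  have hint : ∀ a : α → F, Φ (krPoint θ u a) =
      (Set.univ.pi fun _ : β => O).indicator (fun _ => (1 : ℂ)) u * (Set.univ.pi fun _ : α => O).indicator (fun _ => (1 : ℂ)) a := by
    intro a
    rw [hΦ, apply_krPoint]
    by_cases hu : u ∈ Set.univ.pi (fun _ : β => O)
    · by_cases ha : a ∈ Set.univ.pi (fun _ : α => O)
      · rw [Set.indicator_of_mem ((sumElim_mem_pi_iff h0 u a).2 ⟨hu, ha⟩), Set.indicator_of_mem hu, Set.indicator_of_mem ha, one_mul]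
      · rw [Set.indicator_of_notMem (fun h => ha ((sumElim_mem_pi_iff h0 u a).1 h).2), Set.indicator_of_notMem ha, mul_zero]
    · rw [Set.indicator_of_notMem (fun h => hu ((sumElim_mem_pi_iff h0 u a).1 h).1), Set.indicator_of_notMem hu, zero_mul]
  unfold krFun
  simp_rw [hint]
  rw [integral_const_mul, integral_indicator_const _ hmeas, mul_comm, Complex.real_smul, mul_one]

/-! ## §4 A1: the Kudla–Rallis map is SURJECTIVE (`g ↦ (g ⊗ χ ⊗ φ) ∘ θ` is a section once `χ(0) = 1`, `∫ φ dμ = 1`) -/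

section Surjective

omit [Zero F] [MeasurableSpace (α → F)]

/-- the frame product test function `x ↦ g(θx|_β) · χ(θx|_γ) · φ(θx|_α)`. [cite: KudlaRallis1994, §1] -/
def liftFun (θ : X ≃ₜ ((β ⊕ γ) ⊕ α → F)) (g : (β → F) → ℂ) (χ : (γ → F) → ℂ) (φ : (α → F) → ℂ) (x : X) : ℂ :=
  g (fun b => θ x (Sum.inl (Sum.inl b))) * χ (fun j => θ x (Sum.inl (Sum.inr j))) * φ (fun i => θ x (Sum.inr i))

/-- the product test function is locally constant. [cite: Weil1964, n° 11] -/
theorem isLocallyConstant_liftFun (θ : X ≃ₜ ((β ⊕ γ) ⊕ α → F)) {g : (β → F) → ℂ} {χ : (γ → F) → ℂ} {φ : (α → F) → ℂ}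
    (hg : IsLocallyConstant g) (hχ : IsLocallyConstant χ) (hφ : IsLocallyConstant φ) : IsLocallyConstant (liftFun θ g χ φ) :=
  ((hg.comp_continuous (continuous_pi fun b => (continuous_apply (Sum.inl (Sum.inl b))).comp θ.continuous)).mul
    (hχ.comp_continuous (continuous_pi fun j => (continuous_apply (Sum.inl (Sum.inr j))).comp θ.continuous))).mul
    (hφ.comp_continuous (continuous_pi fun i => (continuous_apply (Sum.inr i)).comp θ.continuous))

/-- the product test function has compact support (inside `θ⁻¹` of the product of the three supports). [cite: Weil1964, n° 11] -/
theorem hasCompactSupport_liftFun [T2Space X] (θ : X ≃ₜ ((β ⊕ γ) ⊕ α → F)) {g : (β → F) → ℂ} {χ : (γ → F) → ℂ} {φ : (α → F) → ℂ}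
    (hg : HasCompactSupport g) (hχ : HasCompactSupport χ) (hφ : HasCompactSupport φ) : HasCompactSupport (liftFun θ g χ φ) := by
  let P : ((β → F) × (γ → F)) × (α → F) → ((β ⊕ γ) ⊕ α → F) := fun p => Sum.elim (Sum.elim p.1.1 p.1.2) p.2
  have hP : Continuous P := continuous_pi fun i => by
    rcases i with (b | j) | i
    · exact (continuous_apply b).comp (continuous_fst.comp continuous_fst)
    · exact (continuous_apply j).comp (continuous_snd.comp continuous_fst)
    · exact (continuous_apply i).comp continuous_snd
  refine HasCompactSupport.intro (θ.isCompact_preimage.2 (((hg.isCompact.prod hχ.isCompact).prod hφ.isCompact).image hP)) fun x hx => ?_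
  by_contra hne
  apply hx
  obtain ⟨hgχ, hφ'⟩ := mul_ne_zero_iff.1 hne
  obtain ⟨hg', hχ'⟩ := mul_ne_zero_iff.1 hgχ
  refine ⟨((fun b => θ x (Sum.inl (Sum.inl b)), fun j => θ x (Sum.inl (Sum.inr j))), fun i => θ x (Sum.inr i)),
    ⟨⟨subset_tsupport _ (Function.mem_support.2 hg'), subset_tsupport _ (Function.mem_support.2 hχ')⟩,
      subset_tsupport _ (Function.mem_support.2 hφ')⟩, ?_⟩
  funext i
  rcases i with (b | j) | i <;> rfl

/-- **the product test function is Schwartz–Bruhat**. [cite: Weil1964, n° 11] -/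
theorem liftFun_mem [T2Space X] (θ : X ≃ₜ ((β ⊕ γ) ⊕ α → F)) {g : (β → F) → ℂ} {χ : (γ → F) → ℂ} {φ : (α → F) → ℂ}
    (hg : g ∈ SchwartzBruhat (β → F)) (hχ : χ ∈ SchwartzBruhat (γ → F)) (hφ : φ ∈ SchwartzBruhat (α → F)) :
    liftFun θ g χ φ ∈ SchwartzBruhat X :=
  ⟨isLocallyConstant_liftFun θ hg.1 hχ.1 hφ.1, hasCompactSupport_liftFun θ hg.2 hχ.2 hφ.2⟩

end Surjective

omit [MeasurableSpace (α → F)] in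
/-- on the slice the product test function reads `g(u) · χ(0) · φ(a)`. [cite: KudlaRallis1994, §1] -/
theorem liftFun_krPoint (θ : X ≃ₜ ((β ⊕ γ) ⊕ α → F)) (g : (β → F) → ℂ) (χ : (γ → F) → ℂ) (φ : (α → F) → ℂ) (u : β → F) (a : α → F) :
    liftFun θ g χ φ (krPoint θ u a) = g u * χ 0 * φ a := by
  unfold liftFun
  rw [apply_krPoint]
  rfl

/-- **`r (g ⊗ χ ⊗ φ ∘ θ) = χ(0) · (∫ φ dμ) · g`**. [cite: KudlaRallis1994, §1] -/
theorem krFun_liftFun (θ : X ≃ₜ ((β ⊕ γ) ⊕ α → F)) (μ : Measure (α → F)) (g : (β → F) → ℂ) (χ : (γ → F) → ℂ) (φ : (α → F) → ℂ)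
    (u : β → F) : krFun θ μ (liftFun θ g χ φ) u = g u * χ 0 * ∫ a, φ a ∂μ := by
  unfold krFun
  simp_rw [liftFun_krPoint]
  exact integral_const_mul _ _

/-- **A1 — THE KUDLA–RALLIS MAP IS SURJECTIVE** `𝒮(X) ↠ 𝒮(F^β)`, given test functions `χ ∈ 𝒮(F^γ)` with `χ(0) = 1` and `φ ∈ 𝒮(F^α)` with `∫ φ dμ = 1`
(at a place `w`: `χ = 𝟙_{𝒪_w^γ}`, `φ = vol(𝒪_w^α)⁻¹ 𝟙_{𝒪_w^α}`): `g = r ((g ⊗ χ ⊗ φ) ∘ θ)`. [cite: KudlaRallis1994, §1] [cite: Liu2011, §2D] -/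
theorem krMap_surjective [T2Space F] [T2Space X] [OpensMeasurableSpace (α → F)] (θ : X ≃ₜ ((β ⊕ γ) ⊕ α → F)) (μ : Measure (α → F))
    [IsFiniteMeasureOnCompacts μ] {χ : (γ → F) → ℂ} (hχ : χ ∈ SchwartzBruhat (γ → F)) (hχ0 : χ 0 = 1)
    {φ : (α → F) → ℂ} (hφ : φ ∈ SchwartzBruhat (α → F)) (hφ1 : ∫ a, φ a ∂μ = 1) :
    Function.Surjective (krMap θ μ) := by
  intro g
  refine ⟨⟨liftFun θ g χ φ, liftFun_mem θ g.2 hχ hφ⟩, Subtype.ext (funext fun u => ?_)⟩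
  show krFun θ μ (liftFun θ (g : (β → F) → ℂ) χ φ) u = (g : (β → F) → ℂ) u
  rw [krFun_liftFun, hχ0, hφ1, mul_one, mul_one]

end Summit.HodgeConjecture.HodgeConjecture.Cruxes.HLiu418.K2LiuKudlaRallisMapDefs

end
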